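import Summits.CriticalPhenomena.PercolationContinuityZ3.Theorems.PercNearOneGluingNoHeavyLowerTailSunflowerSafeCalculus
import Summits.CriticalPhenomena.PercolationContinuityZ3.Theorems.PercNearOneGluingNoHeavyLowerTailSunflowerTwoGeneratorCore
import HarnessLib

/-!
# `NoHeavyLowerTail` (crux stmt-CriticalPhenomena-4575), abstract sunflower cubic: SAFE CORES — the calculus, part 2a
# (block expectations, Fubini, sections, conditioning on a block)

Support file (seat `prim-ineq-prove-1` gen 34; `--supports stmt-CriticalPhenomena-4575`).  No `sorry`, no named facts.  Memo:
run/shared/lean/prim/prim-ineq-prove-1/FINDING-PRINCIPALCORE-prove1-g34.md §9.  Technical layer for `…SunflowerGradedSafe`.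

SETTING.  `μ = prodBernoulli p` on `Set ι` (`ι` finite), a block `a : Finset ι` of coordinates.  For `T ⊆ a` (the MISSING part of the
block) `TwoGenCore.cyl a T` is the cylinder `{ω | ω ∩ a = a ∖ T}` with `μ(cyl a T) = wmiss p a T`.
* `BEx p a F = Σ_{T ⊆ a} wmiss p a T · F T` — block expectation of a function of the missing part; `BEx_mono`, `BEx_affine`, `BEx_const`;
  `wmiss_union`, **`BEx_union`** — Fubini for two disjoint blocks.
* `sect a T V = {ω | (ω ∖ a) ∪ (a ∖ T) ∈ V}` — the SECTION of `V` along the cylinder of `T` (an event determined by `aᶜ`); `sect_anti`,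
  `sect_inter/union/mono`, `determinedBy_sect`, and for events determined by the block / by its complement: `sect_eq_univ_of_mem`,
  `sect_eq_empty_of_not_mem`, `sect_eq_self_of_determinedBy_compl`.
* **`real_eq_BEx`** — conditioning on a block: `μ(V) = Σ_{T ⊆ a} wmiss p a T · μ(sect a T V)` (decomposition `eq_biUnion_cyl_inter_sect` into
  cylinders + independence of `a` and `aᶜ`, `prodBernoulli_real_inter_of_determinedBy`).
-/

noncomputable section

namespace Summit.CriticalPhenomena.PercolationContinuityZ3.Theorems.SunflowerPartition

namespace SafeCalc

open MeasureTheory Finset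
open Literature.Probability.LatticeModels Literature.Probability.Percolation
open TwoGenCore (wmiss cyl)

variable {ι : Type*} [DecidableEq ι]

/-! ## Block expectations -/

/-- Block expectation of a function of the missing part `T ⊆ a`: `BEx p a F = Σ_{T ⊆ a} wmiss p a T · F T`. [this work] -/
def BEx (p : ι → unitInterval) (a : Finset ι) (F : Finset ι → ℝ) : ℝ := ∑ T ∈ a.powerset, wmiss p a T * F T

variable (p : ι → unitInterval)

/-- Cylinder weights are nonnegative. [this work] -/
theorem wmiss_nonneg (a T : Finset ι) : 0 ≤ wmiss p a T :=
  mul_nonneg (Finset.prod_nonneg fun e _ => sub_nonneg.2 (p e).2.2) (Finset.prod_nonneg fun e _ => (p e).2.1)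

/-- Cylinder weights sum to one. [this work] -/
theorem sum_wmiss (a : Finset ι) : ∑ T ∈ a.powerset, wmiss p a T = 1 := by
  rw [TwoGenCore.sum_wmiss_subset p (subset_refl a), Finset.sdiff_self, Finset.prod_empty]

/-- `BEx` is monotone. [this work] -/
theorem BEx_mono (a : Finset ι) {F G : Finset ι → ℝ} (h : ∀ T, T ⊆ a → F T ≤ G T) : BEx p a F ≤ BEx p a G :=
  Finset.sum_le_sum fun T hT => mul_le_mul_of_nonneg_left (h T (Finset.mem_powerset.1 hT)) (wmiss_nonneg p a T)

/-- `BEx` of an affine image. [this work] -/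
theorem BEx_affine (a : Finset ι) (α β : ℝ) (F : Finset ι → ℝ) :
    BEx p a (fun T => α + β * F T) = α + β * BEx p a F := by
  unfold BEx
  simp only [mul_add, Finset.sum_add_distrib, ← Finset.sum_mul, sum_wmiss, one_mul]
  rw [Finset.mul_sum]
  refine congrArg _ (Finset.sum_congr rfl fun T _ => by ring)

/-- `BEx` of a constant. [this work] -/
theorem BEx_const (a : Finset ι) (α : ℝ) : BEx p a (fun _ => α) = α := by
  have h := BEx_affine p a α 0 fun _ => 0
  simp only [zero_mul, add_zero] at h
  exact h

/-- Product formula for cylinder weights of two disjoint blocks. [this work] -/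
theorem wmiss_union {a b : Finset ι} (hab : Disjoint a b) {T₁ T₂ : Finset ι} (h₁ : T₁ ⊆ a) (h₂ : T₂ ⊆ b) :
    wmiss p (a ∪ b) (T₁ ∪ T₂) = wmiss p a T₁ * wmiss p b T₂ := by
  unfold TwoGenCore.wmiss
  have hT : Disjoint T₁ T₂ := hab.mono h₁ h₂
  have hsd : (a ∪ b) \ (T₁ ∪ T₂) = (a \ T₁) ∪ (b \ T₂) := by
    ext e
    simp only [Finset.mem_sdiff, Finset.mem_union]
    constructor
    · rintro ⟨ha | hb, hn⟩
      · exact Or.inl ⟨ha, fun h => hn (Or.inl h)⟩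
      · exact Or.inr ⟨hb, fun h => hn (Or.inr h)⟩
    · rintro (⟨ha, hn⟩ | ⟨hb, hn⟩)
      · exact ⟨Or.inl ha, fun h => h.elim hn fun h2 => Finset.disjoint_left.1 hab ha (h₂ h2)⟩
      · exact ⟨Or.inr hb, fun h => h.elim (fun h1 => Finset.disjoint_left.1 hab (h₁ h1) hb) hn⟩
  have hsd' : Disjoint (a \ T₁) (b \ T₂) := hab.mono Finset.sdiff_subset Finset.sdiff_subset
  rw [hsd, Finset.prod_union hT, Finset.prod_union hsd']
  ring

/-- **Fubini for block expectations**: a block expectation over `a ∪ b` (disjoint) is an iterated one. [this work] -/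
theorem BEx_union {a b : Finset ι} (hab : Disjoint a b) (F : Finset ι → ℝ) :
    BEx p (a ∪ b) F = BEx p a (fun T₁ => BEx p b (fun T₂ => F (T₁ ∪ T₂))) := by
  have hR : BEx p a (fun T₁ => BEx p b (fun T₂ => F (T₁ ∪ T₂))) =
      ∑ x ∈ a.powerset ×ˢ b.powerset, wmiss p a x.1 * (wmiss p b x.2 * F (x.1 ∪ x.2)) := by
    simp only [BEx, Finset.mul_sum, Finset.sum_product]
  rw [hR]
  unfold BEx
  refine Finset.sum_nbij' (fun T => (T ∩ a, T ∩ b)) (fun x => x.1 ∪ x.2) ?_ ?_ ?_ ?_ ?_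
  · intro T _
    exact Finset.mem_product.2 ⟨Finset.mem_powerset.2 Finset.inter_subset_right, Finset.mem_powerset.2 Finset.inter_subset_right⟩
  · intro x hx
    obtain ⟨h1, h2⟩ := Finset.mem_product.1 hx
    exact Finset.mem_powerset.2 (Finset.union_subset_union (Finset.mem_powerset.1 h1) (Finset.mem_powerset.1 h2))
  · intro T hT
    change T ∩ a ∪ T ∩ b = T
    rw [← Finset.inter_union_distrib_left, Finset.inter_eq_left.2 (Finset.mem_powerset.1 hT)]
  · intro x hx
    obtain ⟨h1, h2⟩ := Finset.mem_product.1 hx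
    have h1' := Finset.mem_powerset.1 h1
    have h2' := Finset.mem_powerset.1 h2
    have e1 : (x.1 ∪ x.2) ∩ a = x.1 := by
      rw [Finset.union_inter_distrib_right, Finset.inter_eq_left.2 h1',
        Finset.disjoint_iff_inter_eq_empty.1 (hab.symm.mono_left h2'), Finset.union_empty]
    have e2 : (x.1 ∪ x.2) ∩ b = x.2 := by
      rw [Finset.union_inter_distrib_right, Finset.inter_eq_left.2 h2',
        Finset.disjoint_iff_inter_eq_empty.1 (hab.mono_left h1'), Finset.empty_union]
    exact Prod.ext e1 e2
  · intro T hT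
    have hsplit : T ∩ a ∪ T ∩ b = T := by
      rw [← Finset.inter_union_distrib_left, Finset.inter_eq_left.2 (Finset.mem_powerset.1 hT)]
    change wmiss p (a ∪ b) T * F T = wmiss p a (T ∩ a) * (wmiss p b (T ∩ b) * F (T ∩ a ∪ T ∩ b))
    rw [← mul_assoc, ← wmiss_union p hab Finset.inter_subset_right Finset.inter_subset_right, hsplit]

/-! ## Sections along a block -/

/-- The section of `V` along the cylinder of the block `a` with missing part `T`:
`sect a T V = {ω | (ω ∖ a) ∪ (a ∖ T) ∈ V}` (an event determined by `aᶜ`). [this work] -/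
def sect (a T : Finset ι) (V : Set (Set ι)) : Set (Set ι) := {ω | (ω \ (↑a : Set ι)) ∪ ((a \ T : Finset ι) : Set ι) ∈ V}

variable (a T : Finset ι)

/-- Sections of up-sets are up-sets. [this work] -/
theorem isUpperSet_sect {V : Set (Set ι)} (hV : IsUpperSet V) : IsUpperSet (sect a T V) :=
  fun _ _ hle hω => hV (Set.union_subset_union_left _ (Set.sdiff_subset_sdiff_left hle)) hω

/-- Sections of an up-set shrink as the missing part grows. [this work] -/
theorem sect_anti {T T' : Finset ι} (h : T ⊆ T') {V : Set (Set ι)} (hV : IsUpperSet V) : sect a T' V ⊆ sect a T V :=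
  fun _ hω => hV (Set.union_subset_union_right _ (Finset.coe_subset.2 (Finset.sdiff_subset_sdiff subset_rfl h))) hω

/-- Sections commute with intersections. [this work] -/
theorem sect_inter (V W : Set (Set ι)) : sect a T (V ∩ W) = sect a T V ∩ sect a T W := rfl

/-- Sections commute with unions. [this work] -/
theorem sect_union (V W : Set (Set ι)) : sect a T (V ∪ W) = sect a T V ∪ sect a T W := rfl

/-- Sections are monotone in the event. [this work] -/
theorem sect_mono {V W : Set (Set ι)} (h : V ⊆ W) : sect a T V ⊆ sect a T W := fun _ hω => h hω

/-- A section is determined by the complement of the block. [this work] -/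
theorem determinedBy_sect (V : Set (Set ι)) : DeterminedBy (sect a T V) (↑a : Set ι)ᶜ := by
  rw [determinedBy_iff]
  intro ω ω' h
  simp only [sect, Set.mem_setOf_eq]
  rw [Set.sdiff_eq, Set.sdiff_eq, h]

omit [DecidableEq ι] in
/-- The cylinder of `T` is determined by the block. [this work] -/
theorem determinedBy_cyl : DeterminedBy (cyl a T) (↑a : Set ι) :=
  TwoGenCore.determinedBy_of_mem fun _ _ hag hω e he => (hag e he).symm.trans (hω e he)

/-- The block part of the representative point of a section. [this work] -/
theorem sectPoint_inter (ω : Set ι) :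
    ((ω \ (↑a : Set ι)) ∪ ((a \ T : Finset ι) : Set ι)) ∩ (↑a : Set ι) = ((a \ T : Finset ι) : Set ι) ∩ (↑a : Set ι) := by
  rw [Set.union_inter_distrib_right, Set.sdiff_eq, Set.inter_assoc, Set.compl_inter_self, Set.inter_empty, Set.empty_union]

/-- The off-block part of the representative point of a section. [this work] -/
theorem sectPoint_inter_compl (ω : Set ι) :
    ((ω \ (↑a : Set ι)) ∪ ((a \ T : Finset ι) : Set ι)) ∩ (↑a : Set ι)ᶜ = ω ∩ (↑a : Set ι)ᶜ := by
  have h0 : ((a \ T : Finset ι) : Set ι) ∩ (↑a : Set ι)ᶜ = ∅ := by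
    refine Set.eq_empty_of_forall_notMem fun x hx => hx.2 ?_
    exact Finset.mem_coe.2 (Finset.mem_sdiff.1 (Finset.mem_coe.1 hx.1)).1
  rw [Set.union_inter_distrib_right, Set.sdiff_eq, Set.inter_assoc, Set.inter_self, h0, Set.union_empty]

/-- Section of an event determined by the block, at a good point: everything. [this work] -/
theorem sect_eq_univ_of_mem {a T : Finset ι} {A : Set (Set ι)} (hA : DeterminedBy A (↑a : Set ι))
    (h : ((a \ T : Finset ι) : Set ι) ∈ A) : sect a T A = Set.univ :=
  Set.eq_univ_of_forall fun ω => ((determinedBy_iff A _).1 hA _ _ (sectPoint_inter a T ω)).2 h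

/-- Section of an event determined by the block, at a bad point: nothing. [this work] -/
theorem sect_eq_empty_of_not_mem {a T : Finset ι} {A : Set (Set ι)} (hA : DeterminedBy A (↑a : Set ι))
    (h : ((a \ T : Finset ι) : Set ι) ∉ A) : sect a T A = ∅ :=
  Set.eq_empty_of_forall_notMem fun ω hω => h (((determinedBy_iff A _).1 hA _ _ (sectPoint_inter a T ω)).1 hω)

/-- Sections of an event determined by the complement of the block are the event itself. [this work] -/
theorem sect_eq_self_of_determinedBy_compl {A : Set (Set ι)} (hA : DeterminedBy A (↑a : Set ι)ᶜ) : sect a T A = A :=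
  Set.ext fun ω => (determinedBy_iff A _).1 hA _ _ (sectPoint_inter_compl a T ω)

/-- A configuration in the cylinder of `T` IS the representative point of its section. [this work] -/
theorem union_sdiff_eq_of_mem_cyl {a T : Finset ι} {ω : Set ι} (h : ω ∈ cyl a T) :
    (ω \ (↑a : Set ι)) ∪ ((a \ T : Finset ι) : Set ι) = ω := by
  have h' : ∀ e ∈ a, e ∈ ω ↔ e ∉ T := h
  ext x
  simp only [Set.mem_union, Set.mem_sdiff, Finset.mem_coe, Finset.mem_sdiff]
  by_cases hx : x ∈ a
  · have hxω := h' x hx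
    constructor
    · rintro (⟨hxω', -⟩ | ⟨-, hxT⟩)
      · exact hxω'
      · exact hxω.2 hxT
    · intro hxω'
      exact Or.inr ⟨hx, hxω.1 hxω'⟩
  · constructor
    · rintro (⟨hxω', -⟩ | ⟨hxa, -⟩)
      · exact hxω'
      · exact absurd hxa hx
    · intro hxω'
      exact Or.inl ⟨hxω', hx⟩

/-- Decomposition of an event along the cylinders of a block. [this work] -/
theorem eq_biUnion_cyl_inter_sect (a : Finset ι) (V : Set (Set ι)) : V = ⋃ T ∈ a.powerset, (cyl a T ∩ sect a T V) := by
  classical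
  ext ω
  simp only [Set.mem_iUnion, Set.mem_inter_iff, exists_prop]
  constructor
  · intro hω
    have hc : ω ∈ cyl a (a.filter (· ∉ ω)) := (TwoGenCore.mem_cyl_iff (Finset.filter_subset _ _)).2 rfl
    refine ⟨a.filter (· ∉ ω), Finset.mem_powerset.2 (Finset.filter_subset _ _), hc, ?_⟩
    change (ω \ (↑a : Set ι)) ∪ ((a \ a.filter (· ∉ ω) : Finset ι) : Set ι) ∈ V
    rwa [union_sdiff_eq_of_mem_cyl hc]
  · rintro ⟨T, -, hc, hs⟩
    have hs' : (ω \ (↑a : Set ι)) ∪ ((a \ T : Finset ι) : Set ι) ∈ V := hs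
    rwa [union_sdiff_eq_of_mem_cyl hc] at hs'

/-- **Conditioning on a block**: `μ(V) = Σ_{T ⊆ a} wmiss p a T · μ(sect a T V)` (independence of `a` and `aᶜ`). [this work] -/
theorem real_eq_BEx [Fintype ι] (a : Finset ι) (V : Set (Set ι)) :
    (prodBernoulli p).real V = BEx p a (fun T => (prodBernoulli p).real (sect a T V)) := by
  classical
  conv_lhs => rw [eq_biUnion_cyl_inter_sect a V]
  unfold BEx
  rw [measureReal_biUnion_finset]
  · refine Finset.sum_congr rfl fun T hT => ?_
    rw [Finset.mem_powerset] at hT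
    rw [prodBernoulli_real_inter_of_determinedBy p a (determinedBy_cyl a T) (determinedBy_sect a T V)
      MeasurableSet.of_discrete MeasurableSet.of_discrete, TwoGenCore.real_cyl p hT]
  · intro T hT T' hT' hne
    rw [Function.onFun, Set.disjoint_left]
    rintro ω ⟨hω, -⟩ ⟨hω', -⟩
    rw [Finset.mem_coe, Finset.mem_powerset] at hT hT'
    exact hne (((TwoGenCore.mem_cyl_iff hT).1 hω).symm.trans ((TwoGenCore.mem_cyl_iff hT').1 hω'))
  · intro T _
    exact MeasurableSet.of_discrete

end SafeCalc

end Summit.CriticalPhenomena.PercolationContinuityZ3.Theorems.SunflowerPartition
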